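import Summits.MatrixMultiplication.MatrixMultiplication.Theorems.OutsiderSandwichToricCeilingPowTwoCwBaseDataD
import Summits.MatrixMultiplication.MatrixMultiplication.Theorems.OutsiderSandwichToricCeilingPowTwoCwBaseDataTwoA
import Summits.MatrixMultiplication.MatrixMultiplication.Theorems.OutsiderSandwichToricCeilingPowTwoCwBaseDataTwoD

/-!
# OutsiderSandwich — toric ceiling of `cw₂^{⊠N}`: the `N = 3` two-cw base, TWO-NESS census D
(groups `cX9`, `cX10`, `cX11`; decomp-mm lens 4, gen 47, kernel K47-8 census D; THESES-FREE, `ω`-free;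
helper toward `LaserTangency`, stmt-32268)

LABEL.  TORIC · FINITE (`N = 3`) · NEC-side instrument.  For each group `cXk`, in CHUNKS of at
most 120 instances (kernel memory ceiling on the gate): the second certificate `datbk[i]`
(`…TwoCwBaseDataTwoD`) decodes to a `valid` perfect matching of the instance `(instOf cXk)[i]`
which misses a row of the matching decoded from the first certificate `datak[i]`
(`…TwoCwBaseDataD`) — `census₂_k_r`, `decide +kernel`, standard axioms (no `native_decide`, no
`ofReduceBool`); `lenbk`, `dlenbk`, `cover₂_k` are bookkeeping.  Consumed by `…TwoCwBaseTwo`.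
WHAT THIS IS NOT: no statement about tensors or `ω`.
-/

set_option linter.dupNamespace false
set_option maxRecDepth 200000
set_option Elab.async false

namespace Summit.MatrixMultiplication.MatrixMultiplication.Theorems.OutsiderSandwichToricCeilingPowTwoCwBaseCensusTwoD

open Summit.MatrixMultiplication.MatrixMultiplication.Theorems.OutsiderSandwichToricCeilingPowTwoCwBaseDefs
open Summit.MatrixMultiplication.MatrixMultiplication.Theorems.OutsiderSandwichToricCeilingPowTwoCwBaseDataD
open Summit.MatrixMultiplication.MatrixMultiplication.Theorems.OutsiderSandwichToricCeilingPowTwoCwBaseDataTwoA (goodD₂)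
open Summit.MatrixMultiplication.MatrixMultiplication.Theorems.OutsiderSandwichToricCeilingPowTwoCwBaseDataTwoD

set_option maxHeartbeats 0 in
/-- Group `cX9`: the second-certificate list has the length of the instance list (318). -/
theorem lenb9 : (instOf cX9).length = datb9.length := by
  decide +kernel

/-- Group `cX9`: number of second certificates. -/
theorem dlenb9 : datb9.length = 318 := by
  decide +kernel

set_option maxHeartbeats 0 in
/-- TWO-NESS CENSUS, group `cX9`, instances `0 … 119` (kernel-decided): each second
certificate decodes to a valid perfect matching missing a row of the first one. -/
theorem census₂_9_0 : ((((instOf cX9).zip (data9.zip datb9)).drop 0).take 120).all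
    (fun p => goodD₂ p.1 p.2.1 p.2.2) = true := by
  decide +kernel

set_option maxHeartbeats 0 in
/-- TWO-NESS CENSUS, group `cX9`, instances `120 … 239` (kernel-decided): each second
certificate decodes to a valid perfect matching missing a row of the first one. -/
theorem census₂_9_1 : ((((instOf cX9).zip (data9.zip datb9)).drop 120).take 120).all
    (fun p => goodD₂ p.1 p.2.1 p.2.2) = true := by
  decide +kernel

set_option maxHeartbeats 0 in
/-- TWO-NESS CENSUS, group `cX9`, instances `240 … 317` (kernel-decided): each second
certificate decodes to a valid perfect matching missing a row of the first one. -/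
theorem census₂_9_2 : ((((instOf cX9).zip (data9.zip datb9)).drop 240).take 78).all
    (fun p => goodD₂ p.1 p.2.1 p.2.2) = true := by
  decide +kernel

/-- Group `cX9`: every index is covered by a decided chunk. -/
theorem cover₂_9 : ∀ i < datb9.length, ∃ lo n, lo ≤ i ∧ i < lo + n ∧
    ((((instOf cX9).zip (data9.zip datb9)).drop lo).take n).all
      (fun p => goodD₂ p.1 p.2.1 p.2.2) = true := by
  intro i hi
  rw [dlenb9] at hi
  by_cases h0 : i < 120
  · exact ⟨0, 120, by omega, by omega, census₂_9_0⟩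
  by_cases h1 : i < 240
  · exact ⟨120, 120, by omega, by omega, census₂_9_1⟩
  · exact ⟨240, 78, by omega, by omega, census₂_9_2⟩

set_option maxHeartbeats 0 in
/-- Group `cX10`: the second-certificate list has the length of the instance list (324). -/
theorem lenb10 : (instOf cX10).length = datb10.length := by
  decide +kernel

/-- Group `cX10`: number of second certificates. -/
theorem dlenb10 : datb10.length = 324 := by
  decide +kernel

set_option maxHeartbeats 0 in
/-- TWO-NESS CENSUS, group `cX10`, instances `0 … 119` (kernel-decided): each second
certificate decodes to a valid perfect matching missing a row of the first one. -/
theorem census₂_10_0 : ((((instOf cX10).zip (data10.zip datb10)).drop 0).take 120).all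
    (fun p => goodD₂ p.1 p.2.1 p.2.2) = true := by
  decide +kernel

set_option maxHeartbeats 0 in
/-- TWO-NESS CENSUS, group `cX10`, instances `120 … 239` (kernel-decided): each second
certificate decodes to a valid perfect matching missing a row of the first one. -/
theorem census₂_10_1 : ((((instOf cX10).zip (data10.zip datb10)).drop 120).take 120).all
    (fun p => goodD₂ p.1 p.2.1 p.2.2) = true := by
  decide +kernel

set_option maxHeartbeats 0 in
/-- TWO-NESS CENSUS, group `cX10`, instances `240 … 323` (kernel-decided): each second
certificate decodes to a valid perfect matching missing a row of the first one. -/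
theorem census₂_10_2 : ((((instOf cX10).zip (data10.zip datb10)).drop 240).take 84).all
    (fun p => goodD₂ p.1 p.2.1 p.2.2) = true := by
  decide +kernel

/-- Group `cX10`: every index is covered by a decided chunk. -/
theorem cover₂_10 : ∀ i < datb10.length, ∃ lo n, lo ≤ i ∧ i < lo + n ∧
    ((((instOf cX10).zip (data10.zip datb10)).drop lo).take n).all
      (fun p => goodD₂ p.1 p.2.1 p.2.2) = true := by
  intro i hi
  rw [dlenb10] at hi
  by_cases h0 : i < 120
  · exact ⟨0, 120, by omega, by omega, census₂_10_0⟩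
  by_cases h1 : i < 240
  · exact ⟨120, 120, by omega, by omega, census₂_10_1⟩
  · exact ⟨240, 84, by omega, by omega, census₂_10_2⟩

set_option maxHeartbeats 0 in
/-- Group `cX11`: the second-certificate list has the length of the instance list (208). -/
theorem lenb11 : (instOf cX11).length = datb11.length := by
  decide +kernel

/-- Group `cX11`: number of second certificates. -/
theorem dlenb11 : datb11.length = 208 := by
  decide +kernel

set_option maxHeartbeats 0 in
/-- TWO-NESS CENSUS, group `cX11`, instances `0 … 119` (kernel-decided): each second
certificate decodes to a valid perfect matching missing a row of the first one. -/
theorem census₂_11_0 : ((((instOf cX11).zip (data11.zip datb11)).drop 0).take 120).all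
    (fun p => goodD₂ p.1 p.2.1 p.2.2) = true := by
  decide +kernel

set_option maxHeartbeats 0 in
/-- TWO-NESS CENSUS, group `cX11`, instances `120 … 207` (kernel-decided): each second
certificate decodes to a valid perfect matching missing a row of the first one. -/
theorem census₂_11_1 : ((((instOf cX11).zip (data11.zip datb11)).drop 120).take 88).all
    (fun p => goodD₂ p.1 p.2.1 p.2.2) = true := by
  decide +kernel

/-- Group `cX11`: every index is covered by a decided chunk. -/
theorem cover₂_11 : ∀ i < datb11.length, ∃ lo n, lo ≤ i ∧ i < lo + n ∧
    ((((instOf cX11).zip (data11.zip datb11)).drop lo).take n).all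
      (fun p => goodD₂ p.1 p.2.1 p.2.2) = true := by
  intro i hi
  rw [dlenb11] at hi
  by_cases h0 : i < 120
  · exact ⟨0, 120, by omega, by omega, census₂_11_0⟩
  · exact ⟨120, 88, by omega, by omega, census₂_11_1⟩

end Summit.MatrixMultiplication.MatrixMultiplication.Theorems.OutsiderSandwichToricCeilingPowTwoCwBaseCensusTwoD
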